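import Summits.ABC.IUTFork.Repair.RHLabelCutGenuine
import Summits.ABC.IUTFork.Repair.ObstructionSS28LabelCut
import HarnessLib

/-!
# IUT REPAIR branch → R-H (D-0079 «local-height» programme): the C1 LABEL-CUT k2 DOOR AT THE GENUINE BED — part 2:
# for a constant cut `j₀` the above-cut FLOOR MASS is a NUMBER of the datum, `PN(i ↦ [i+1 > j₀]·((i+1)² − 1)) · deĝ̲(P_q)`, and it is STRICTLY POSITIVE below `l⋆`

PROOF-ONLY sequel (D-0012: 0 definitions, 0 `Prop` facts; abc-iut cell, rung LADDER-ABC:A2.B ⊇ A2.RP → A2.RESCUE-H; seat abc-iut-rp-h1 gen 12, R-H k2 hand #7;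
abc-iut-rh-lead «GO rp-h1 C1 LABEL-CUT k2 TEMPLATE» 2026-08-26T15:23:52Z) of `RHLabelCutGenuine` (part 1: the cut door and the NUMBERS door at
abc-iut-c312-7's `settingPrVolSharp X …` with realising ideles, PIN-FREE). TAKES NO SIDE on [IUTchIII] Cor. 3.12 or on any author; candidates are
hypotheses; typed ≠ proved; instantiated ≠ endorsed; DEFS-FREEZE respected (consumed BY NAME: abc-iut-rp-s2 `ObstructionSS28LabelCut`
(`floorMassAbove_eq_of_indep`) / `ObstructionSS28Window` (`statement_iff_avg_cellSlack`), abc-iut-rp-h3 `CandInternal11GapLabelCut`, abc-iut-c312-7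
`negLogQ_settingPrVolSharp`, this lineage's `CandDupuyHilado13.qLocal_indep_settingPrVolSharp` / `ndeg_qPilot_pos` p433905). Inputs ⊆ the frozen FACT-LIST;
standard axioms. Bed, binders and the cell slack `σ` / floor as in part 1.

WHAT THIS FILE PROVES (namespace `Summit.ABC.IUTFork.Repair.RHLabelCutGenuine`, continued).
* §1b `cellSlack_nonneg_settingPrVolSharp_of_licenceAt` (a licence cell signs its slack at the bed); `licence_settingPrVolSharp_of_licenceBelow_of_lstar_le`
  (cut at or above `l⋆` everywhere: the below-cut licence cells ARE the (xi-f) Licence and the Statement follows with no door).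
* §3 CONSTANT CUT `j₀ : ℕ`. Label-independence of the q-volume is a THEOREM of the bed (`qLocal_indep_settingPrVolSharp`) and `−|log(q)| = −deĝ̲(P_q)`
  (`negLogQ_settingPrVolSharp`), so abc-iut-rp-s2's `floorMassAbove_eq_of_indep` reads **`floorMassAbove_settingPrVolSharp_eq`**:
  `PN(i ↦ [i+1 > j₀]·Σᶠ_v floor) = PN(i ↦ [i+1 > j₀]·((i+1)² − 1)) · deĝ̲(P_q)` — a NUMBER of the datum (`l⋆`, `j₀`, `deĝ̲(P_q) = deĝ̲(𝔮)/(2l)`); its ratio to the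
  full demand `(PN(j²) − 1)·deĝ̲(P_q)` is FUNNEL-NOTES G2's off-window demand share `Σ_{j > j₀}(j² − 1)/Σ_j (j² − 1)`. Hence the EXPLICIT door
  **`statement_settingPrVolSharp_of_surplusBelow_ge_explicitFloorMass`** (below-cut surplus numbers `s ≤ σ` with `PN([i+1 > j₀]·((i+1)² − 1))·deĝ̲(P_q) ≤
  PN([i+1 ≤ j₀]·Σᶠ s)` ⟹ Statement) and the HONEST VERDICT LEMMA **`explicitFloorMass_settingPrVolSharp_pos`**: for every cut `j₀ < l⋆` the above-cut floor
  mass is STRICTLY POSITIVE (`deĝ̲(P_q) > 0`). So at genuine data a label-cut candidate whose only below-cut input is «licence / I06⋆ cells» (surplus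
  signed, no number) NEVER opens the door by itself (`not_explicitFloorMass_le_zero_of_lt`; `lstar_le_of_explicitFloorMass_nonpos`;
  `statement_settingPrVolSharp_of_licenceBelow_of_explicitFloorMass_nonpos` records the degenerate end `j₀ ≥ l⋆`): it must bring STRICTLY POSITIVE
  below-cut surplus numbers, i.e. a hull-volume input — the theorem-grade form, at the bed of record, of abc-iut-rh-lead's routing prediction for rows
  1/9/13 of plan/rescue/R-H/RH-CANDIDATES.tsv («KEPT only together with a hull statement at high labels») and of abc-iut-rp-s2's HONEST NOTE 16:24:59Z.
HONEST SCOPE as in part 1; nothing here decides a surplus number at genuine data. [claim: Mochizuki2012, status: disputed] for every [IUTchIII]/[IUTchIV]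
locution; [cite: ScholzeStix2018, §2.2 pp. 9–10]; [cite: DupuyHilado2025, §3.3, (3.4), Thm 3.10.1]. Axioms: standard.
-/

noncomputable section

open Set Function NumberField IsDedekindDomain

namespace Summit.ABC.IUTFork.Repair.RHLabelCutGenuine

open Thm311 Thm311.Real Cor312 Cor312Vol Literature.IUT.LogThetaLattice Literature.IUT.LogVolume Literature.IUT.HodgeTheaters
open Summit.ABC.IUTFork.Repair.ObstructionSS28Window Summit.ABC.IUTFork.Repair.ObstructionSS28Budget
open Summit.ABC.IUTFork.Repair.CandInternal11GapLabelCut Summit.ABC.IUTFork.Repair.ObstructionSS28LabelCut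
open Repair.CandDupuyHilado13 (ndeg_qPilot_pos qLocal_indep_settingPrVolSharp)

variable {F : Type} [Field F] [NumberField F] (X : PilotData F) {logv : PadicLogs F} (hlog : LogvAnalytic logv)
  (M : Type) [Field M] [NumberField M]
  (archPk : ∀ (j : (thetaIndex X).Label) (vQ : (thetaIndex X).VQ), Set ((logShellsDH X logv).Packet j vQ))
  (archSub : ∀ (j : (thetaIndex X).Label) (v : (thetaIndex X).V),
    Set ((logShellsDH X logv).Packet j ((thetaIndex X).over v)))
  (Ψ : ℤ → ∀ v : (thetaIndex X).V, v ∈ (thetaIndex X).Vbad → Set ((logShellsDH X logv).StarPacket v))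
  (act : ℤ → ∀ v : (thetaIndex X).V, v ∈ (thetaIndex X).Vbad →
    (logShellsDH X logv).StarPacket v → Module.End ℚ ((logShellsDH X logv).StarPacket v))
  (Mmod : ℤ → ∀ j : (thetaIndex X).LabelStar, Set ((logShellsDH X logv).GlobalPacket j.1))
  (region : ℤ → ∀ j : (thetaIndex X).LabelStar, FinDivisor M → ∀ vQ : (thetaIndex X).VQ,
    Set ((logShellsDH X logv).Packet j.1 vQ))
  (n : ℤ) {HT : Type} {LogLink : HT → HT → Type} {IsFull : ∀ {s t : HT}, LogLink s t → Prop}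
  (lat : LGPGaussianLogThetaLattice LogLink IsFull)
  {Frd : Type} {IsoF : Frd → Frd → Type} {Ob : Frd → Type} {realify : Frd → Frd} {Strip : Type}
  {IsoS : Strip → Strip → Type} {Mv : ∀ v : (thetaIndex X).V, v ∈ (thetaIndex X).Vbad → Type}
  [∀ v h, Monoid (Mv v h)]
  (sig : GlobalLGPFrobenioidSignature (thetaIndex X).lstar (thetaIndex X).V (· ∈ (thetaIndex X).Vbad)
    Frd IsoF Ob realify Strip IsoS Mv)
  (split : SplittingMonoids Mv) {ObΔ : Type} {N : ∀ v : (thetaIndex X).V, v ∈ (thetaIndex X).Vbad → Type}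
  [∀ v h, Monoid (N v h)] (qData : QPilotData ObΔ N)
  (t : ∀ (pp : Nat.Primes) (_ : Fin X.lstar) (x : (thetaIndex X).Fibre (.inr pp)),
    haveI : Fact (pp : ℕ).Prime := ⟨pp.2⟩; kOf X pp.1 x)
  (tq : ∀ (pp : Nat.Primes) (x : (thetaIndex X).Fibre (.inr pp)), haveI : Fact (pp : ℕ).Prime := ⟨pp.2⟩; kOf X pp.1 x)
  (ht0 : ∀ pp i x, t pp i x ≠ 0)
  /- the Θ-ideles REALISE `P_Θ` in Dupuy–Hilado's normalisation (3.4) -/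
  (ht : ∀ (pp : Nat.Primes) (i : Fin X.lstar) (x : (thetaIndex X).Fibre (.inr pp)),
    haveI : Fact (pp : ℕ).Prime := ⟨pp.2⟩
    Real.log ‖t pp i x‖ = -(X.thetaPilot i (placeOf X pp.1 x)) * logNorm F (placeOf X pp.1 x) / localDegree F (placeOf X pp.1 x))
  (htq0 : ∀ pp x, tq pp x ≠ 0)
  (htq1 : ∀ (pp : Nat.Primes) (x : (thetaIndex X).Fibre (.inr pp)),
    haveI : Fact (pp : ℕ).Prime := ⟨pp.2⟩; placeOf X pp.1 x ∉ X.S → ‖tq pp x‖ = 1)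
  /- the q-ideles REALISE `P_q` -/
  (htq : ∀ (pp : Nat.Primes) (x : (thetaIndex X).Fibre (.inr pp)),
    haveI : Fact (pp : ℕ).Prime := ⟨pp.2⟩
    Real.log ‖tq pp x‖ = -(X.qPilot (placeOf X pp.1 x)) * logNorm F (placeOf X pp.1 x) / localDegree F (placeOf X pp.1 x))

/-! ## §1b. A licence cell signs its slack; the degenerate cut `j₀ ≥ l⋆` -/

include ht0 ht in
/-- **A licence cell signs its slack at the bed**: `qRegion ⊆ ⁿ˒°𝒰` at `(i+1, v_ℚ)` gives `0 ≤ σ_{i+1,v_ℚ}` (abc-iut-rp-s2's volume shadow with the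
bed's bridge hypotheses discharged). [claim: Mochizuki2012, status: disputed] -/
theorem cellSlack_nonneg_settingPrVolSharp_of_licenceAt (i : Fin (thetaIndex X).lstar) (vQ : (thetaIndex X).VQ)
    (hL : (settingPrVolSharp X hlog M archPk archSub Ψ act Mmod region n lat sig split qData tq t htq0 htq1).qRegion
        (Setting.labelSucc i) vQ ⊆
      (settingPrVolSharp X hlog M archPk archSub Ψ act Mmod region n lat sig split qData tq t htq0 htq1).thetaHull
        (Setting.labelSucc i) vQ) :
    0 ≤ ((situationPrVol X hlog M archPk archSub Ψ act Mmod region).D n).logvol _ vQ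
          ((settingPrVolSharp X hlog M archPk archSub Ψ act Mmod region n lat sig split qData tq t htq0 htq1).thetaHull
            (Setting.labelSucc i) vQ) -
        (settingPrVolSharp X hlog M archPk archSub Ψ act Mmod region n lat sig split qData tq t htq0 htq1).qLocal
          (Setting.labelSucc i) vQ :=
  ObstructionSS28Window.cellSlack_nonneg_of_licenceAt
    (LatticeSituation.ofShells (logShellsDH X logv) M archPk archSub (summandPiecesPr X hlog).Adm (summandPiecesPr X hlog).logvol Ψ act
      Mmod region (fun _ _ => (summandPiecesPr X hlog).Adm) (fun _ _ => (summandPiecesPr X hlog).logvol) (fun k _ => Ψ k)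
      (fun k _ => Mmod k) (fun _ _ _ _ _ => ∅) (fun _ _ _ _ => ∅) (fun _ _ _ => 0))
    (settingPrVolSharp X hlog M archPk archSub Ψ act Mmod region n lat sig split qData tq t htq0 htq1)
    (bridgeHyps X hlog M archPk archSub Ψ act Mmod region n lat sig split qData t tq ht0 ht htq0 htq1) i vQ hL

section CutTop

variable (j₀ : (thetaIndex X).VQ → ℕ)

include ht0 ht in
/-- **Cut at or above `l⋆` everywhere: the below-cut licence cells ARE the (xi-f) Licence, and the Statement follows with no door**
(abc-iut-rp-h3's `licence_of_licenceBelow`, abc-iut-c312-1's `statement_of_licence`). [claim: Mochizuki2012, status: disputed] -/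
theorem licence_settingPrVolSharp_of_licenceBelow_of_lstar_le (htop : ∀ vQ : (thetaIndex X).VQ, (thetaIndex X).lstar ≤ j₀ vQ)
    (hbelow : ∀ (i : Fin (thetaIndex X).lstar) (vQ : (thetaIndex X).VQ), (i : ℕ) + 1 ≤ j₀ vQ →
      (settingPrVolSharp X hlog M archPk archSub Ψ act Mmod region n lat sig split qData tq t htq0 htq1).qRegion (Setting.labelSucc i) vQ ⊆
        (settingPrVolSharp X hlog M archPk archSub Ψ act Mmod region n lat sig split qData tq t htq0 htq1).thetaHull (Setting.labelSucc i) vQ) :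
    Thm311ToCor312.Licence (settingPrVolSharp X hlog M archPk archSub Ψ act Mmod region n lat sig split qData tq t htq0 htq1) ∧
      (settingPrVolSharp X hlog M archPk archSub Ψ act Mmod region n lat sig split qData tq t htq0 htq1).Statement := by
  have hL : Thm311ToCor312.Licence (settingPrVolSharp X hlog M archPk archSub Ψ act Mmod region n lat sig split qData tq t htq0 htq1) :=
    fun i vQ => hbelow i vQ ((Nat.succ_le_of_lt i.2).trans (htop vQ))
  exact ⟨hL, Thm311ToCor312.statement_of_licence
    (bridgeHyps X hlog M archPk archSub Ψ act Mmod region n lat sig split qData t tq ht0 ht htq0 htq1) hL⟩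

end CutTop

/-! ## §3. Constant cut `j₀ : ℕ`: the above-cut floor mass is a NUMBER of the datum -/

section ConstantCut

variable (j₀ : ℕ)

include htq in
/-- **THE ABOVE-CUT FLOOR MASS IN CLOSED FORM AT THE BED**: `PN(i ↦ [i+1 > j₀]·Σᶠ_v floor) = PN(i ↦ [i+1 > j₀]·((i+1)² − 1)) · deĝ̲(P_q)` —
abc-iut-rp-s2's `floorMassAbove_eq_of_indep` with label-independence of the q-volume a THEOREM of the bed (this lineage's
`qLocal_indep_settingPrVolSharp`) and `−|log(q)| = −deĝ̲(P_q)` (abc-iut-c312-7 `negLogQ_settingPrVolSharp`). Its ratio to the full demand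
`((κ − 1)·deĝ̲(P_q)`, κ − 1 = PN(j²) − 1)` is FUNNEL-NOTES G2's off-window demand share `Σ_{j > j₀}(j² − 1)/Σ_j (j² − 1)`.
[cite: DupuyHilado2025, §3.3, Thm 3.10.1] [claim: Mochizuki2012, status: disputed] -/
theorem floorMassAbove_settingPrVolSharp_eq :
    processionNormalized (fun i : Fin (thetaIndex X).lstar => if (i : ℕ) + 1 ≤ j₀ then 0 else
        ∑ᶠ vQ : (thetaIndex X).VQ, ((((i : ℕ) + 1 : ℕ) : ℝ) ^ 2 - 1) *
          (-(settingPrVolSharp X hlog M archPk archSub Ψ act Mmod region n lat sig split qData tq t htq0 htq1).qLocal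
            (Setting.labelSucc i) vQ)) =
      processionNormalized (fun i : Fin (thetaIndex X).lstar => if (i : ℕ) + 1 ≤ j₀ then (0 : ℝ) else ((((i : ℕ) + 1 : ℕ) : ℝ) ^ 2 - 1)) *
        FinDivisor.ndeg F X.qPilot := by
  have h := ObstructionSS28LabelCut.floorMassAbove_eq_of_indep
    (LatticeSituation.ofShells (logShellsDH X logv) M archPk archSub (summandPiecesPr X hlog).Adm (summandPiecesPr X hlog).logvol Ψ act
      Mmod region (fun _ _ => (summandPiecesPr X hlog).Adm) (fun _ _ => (summandPiecesPr X hlog).logvol) (fun k _ => Ψ k)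
      (fun k _ => Mmod k) (fun _ _ _ _ _ => ∅) (fun _ _ _ _ => ∅) (fun _ _ _ => 0))
    (settingPrVolSharp X hlog M archPk archSub Ψ act Mmod region n lat sig split qData tq t htq0 htq1) j₀
    (qLocal_indep_settingPrVolSharp X hlog M archPk archSub Ψ act Mmod region n lat sig split qData t tq htq0 htq1 htq)
  erw [negLogQ_settingPrVolSharp X hlog M archPk archSub Ψ act Mmod region n lat sig split qData t tq htq0 htq1 htq, neg_neg] at h
  exact h

/-- The label coefficient `PN(i ↦ [i+1 > j₀]·((i+1)² − 1))` is nonnegative. [folklore] -/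
theorem labelCoeff_nonneg :
    0 ≤ processionNormalized (fun i : Fin (thetaIndex X).lstar =>
      if (i : ℕ) + 1 ≤ j₀ then (0 : ℝ) else ((((i : ℕ) + 1 : ℕ) : ℝ) ^ 2 - 1)) := by
  unfold processionNormalized
  refine div_nonneg (Finset.sum_nonneg fun i _ => ?_) (Nat.cast_nonneg _)
  split_ifs
  · exact le_rfl
  · have h1 : (1 : ℝ) ≤ (((i : ℕ) + 1 : ℕ) : ℝ) := by exact_mod_cast Nat.succ_le_succ (Nat.zero_le _)
    nlinarith

/-- **For a cut BELOW `l⋆` the label coefficient is STRICTLY POSITIVE**: the top label `l⋆` lies above the cut and carries `(l⋆)² − 1 ≥ 3`.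
[folklore] -/
theorem labelCoeff_pos (hj : j₀ < (thetaIndex X).lstar) :
    0 < processionNormalized (fun i : Fin (thetaIndex X).lstar =>
      if (i : ℕ) + 1 ≤ j₀ then (0 : ℝ) else ((((i : ℕ) + 1 : ℕ) : ℝ) ^ 2 - 1)) := by
  have hl : 0 < (thetaIndex X).lstar := lt_of_lt_of_le (by norm_num) (thetaIndex X).two_le_lstar
  unfold processionNormalized
  refine div_pos ?_ (by exact_mod_cast hl)
  -- the top label index `l⋆ − 1`
  set itop : Fin (thetaIndex X).lstar := ⟨(thetaIndex X).lstar - 1, Nat.sub_lt hl Nat.one_pos⟩ with hitop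
  have htop : ¬ ((itop : ℕ) + 1 ≤ j₀) := by
    simp only [hitop]
    omega
  have hterm : 0 < (if (itop : ℕ) + 1 ≤ j₀ then (0 : ℝ) else ((((itop : ℕ) + 1 : ℕ) : ℝ) ^ 2 - 1)) := by
    rw [if_neg htop]
    have h2 : (2 : ℝ) ≤ (((itop : ℕ) + 1 : ℕ) : ℝ) := by
      have : 2 ≤ (itop : ℕ) + 1 := by simp only [hitop]; have := (thetaIndex X).two_le_lstar; omega
      exact_mod_cast this
    nlinarith
  refine lt_of_lt_of_le hterm (Finset.single_le_sum (f := fun i : Fin (thetaIndex X).lstar =>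
      if (i : ℕ) + 1 ≤ j₀ then (0 : ℝ) else ((((i : ℕ) + 1 : ℕ) : ℝ) ^ 2 - 1)) (fun i _ => ?_) (Finset.mem_univ itop))
  split_ifs
  · exact le_rfl
  · have h1 : (1 : ℝ) ≤ (((i : ℕ) + 1 : ℕ) : ℝ) := by exact_mod_cast Nat.succ_le_succ (Nat.zero_le _)
    nlinarith

include htq in
/-- **HONEST VERDICT LEMMA: AT GENUINE DATA THE ABOVE-CUT FLOOR MASS OF EVERY CUT `j₀ < l⋆` IS STRICTLY POSITIVE** (`deĝ̲(P_q) > 0`,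
`CandDupuyHilado13.ndeg_qPilot_pos`). So a label-cut candidate whose only below-cut input is «licence / I06⋆ cells» (surplus signed `≥ 0`, no number)
cannot meet the worst-case door: it must bring STRICTLY POSITIVE below-cut surplus, i.e. a hull-volume input — rows 1/9/13 of
plan/rescue/R-H/RH-CANDIDATES.tsv «KEPT only together with a hull statement», in kernel at the bed of record. [claim: Mochizuki2012, status: disputed] -/
theorem explicitFloorMass_settingPrVolSharp_pos (hj : j₀ < (thetaIndex X).lstar) :
    0 < processionNormalized (fun i : Fin (thetaIndex X).lstar => if (i : ℕ) + 1 ≤ j₀ then 0 else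
        ∑ᶠ vQ : (thetaIndex X).VQ, ((((i : ℕ) + 1 : ℕ) : ℝ) ^ 2 - 1) *
          (-(settingPrVolSharp X hlog M archPk archSub Ψ act Mmod region n lat sig split qData tq t htq0 htq1).qLocal
            (Setting.labelSucc i) vQ)) := by
  rw [floorMassAbove_settingPrVolSharp_eq X hlog M archPk archSub Ψ act Mmod region n lat sig split qData t tq htq0 htq1 htq j₀]
  exact mul_pos (labelCoeff_pos X j₀ hj) (ndeg_qPilot_pos X)

include htq in
/-- **… hence «floor mass ≤ 0» (the worst-case door fed with surplus numbers `s = 0`, i.e. with nothing but signed cells) FAILS for every cut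
below `l⋆`.** [claim: Mochizuki2012, status: disputed] -/
theorem not_explicitFloorMass_le_zero_of_lt (hj : j₀ < (thetaIndex X).lstar) :
    ¬ processionNormalized (fun i : Fin (thetaIndex X).lstar => if (i : ℕ) + 1 ≤ j₀ then 0 else
        ∑ᶠ vQ : (thetaIndex X).VQ, ((((i : ℕ) + 1 : ℕ) : ℝ) ^ 2 - 1) *
          (-(settingPrVolSharp X hlog M archPk archSub Ψ act Mmod region n lat sig split qData tq t htq0 htq1).qLocal
            (Setting.labelSucc i) vQ)) ≤ 0 :=
  not_le.mpr (explicitFloorMass_settingPrVolSharp_pos X hlog M archPk archSub Ψ act Mmod region n lat sig split qData t tq htq0 htq1 htq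
    j₀ hj)

include htq in
/-- Conversely, «floor mass ≤ 0» forces the cut to sit at or above `l⋆` (where §2's `licence_settingPrVolSharp_of_licenceBelow_of_lstar_le` applies:
the Licence itself, no door). [claim: Mochizuki2012, status: disputed] -/
theorem lstar_le_of_explicitFloorMass_nonpos
    (h : processionNormalized (fun i : Fin (thetaIndex X).lstar => if (i : ℕ) + 1 ≤ j₀ then 0 else
        ∑ᶠ vQ : (thetaIndex X).VQ, ((((i : ℕ) + 1 : ℕ) : ℝ) ^ 2 - 1) *
          (-(settingPrVolSharp X hlog M archPk archSub Ψ act Mmod region n lat sig split qData tq t htq0 htq1).qLocal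
            (Setting.labelSucc i) vQ)) ≤ 0) :
    (thetaIndex X).lstar ≤ j₀ := by
  by_contra hlt
  exact not_explicitFloorMass_le_zero_of_lt X hlog M archPk archSub Ψ act Mmod region n lat sig split qData t tq htq0 htq1 htq j₀
    (not_le.mp hlt) h

include ht0 ht htq in
/-- Label by label, at the bed: minus the floor sum ≤ the slack sum (§1 pointwise, PIN-FREE). [claim: Mochizuki2012, status: disputed] -/
theorem finsum_cellSlack_ge_neg_finsum_floor_settingPrVolSharp (i : Fin (thetaIndex X).lstar) :
    -∑ᶠ vQ : (thetaIndex X).VQ, ((((i : ℕ) + 1 : ℕ) : ℝ) ^ 2 - 1) *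
        (-(settingPrVolSharp X hlog M archPk archSub Ψ act Mmod region n lat sig split qData tq t htq0 htq1).qLocal
          (Setting.labelSucc i) vQ) ≤
      ∑ᶠ vQ : (thetaIndex X).VQ,
        (((situationPrVol X hlog M archPk archSub Ψ act Mmod region).D n).logvol _ vQ
            ((settingPrVolSharp X hlog M archPk archSub Ψ act Mmod region n lat sig split qData tq t htq0 htq1).thetaHull
              (Setting.labelSucc i) vQ) -
          (settingPrVolSharp X hlog M archPk archSub Ψ act Mmod region n lat sig split qData tq t htq0 htq1).qLocal
            (Setting.labelSucc i) vQ) := by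
  have hfin := thetaFinite X hlog M archPk archSub Ψ act Mmod region n lat sig split qData t tq ht0 ht htq0 htq1
  rw [← finsum_neg_distrib]
  exact finsum_le_finsum'
    ((ObstructionSS28Budget.floor_support_finite
      (LatticeSituation.ofShells (logShellsDH X logv) M archPk archSub (summandPiecesPr X hlog).Adm (summandPiecesPr X hlog).logvol Ψ act
        Mmod region (fun _ _ => (summandPiecesPr X hlog).Adm) (fun _ _ => (summandPiecesPr X hlog).logvol) (fun k _ => Ψ k)
        (fun k _ => Mmod k) (fun _ _ _ _ _ => ∅) (fun _ _ _ _ => ∅) (fun _ _ _ => 0))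
      (settingPrVolSharp X hlog M archPk archSub Ψ act Mmod region n lat sig split qData tq t htq0 htq1) i).subset
      (Function.support_neg _).le)
    (ObstructionSS28Window.cellSlack_support_finite
      (LatticeSituation.ofShells (logShellsDH X logv) M archPk archSub (summandPiecesPr X hlog).Adm (summandPiecesPr X hlog).logvol Ψ act
        Mmod region (fun _ _ => (summandPiecesPr X hlog).Adm) (fun _ _ => (summandPiecesPr X hlog).logvol) (fun k _ => Ψ k)
        (fun k _ => Mmod k) (fun _ _ _ _ _ => ∅) (fun _ _ _ _ => ∅) (fun _ _ _ => 0))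
      (settingPrVolSharp X hlog M archPk archSub Ψ act Mmod region n lat sig split qData tq t htq0 htq1) hfin i)
    fun vQ => cellSlack_ge_neg_floor_settingPrVolSharp X hlog M archPk archSub Ψ act Mmod region n lat sig split qData t tq ht0 ht htq0
      htq1 htq i vQ

include ht0 ht htq in
/-- **THE EXPLICIT NUMBERS DOOR AT THE BED (constant cut).** Finitely supported below-cut surplus bounds `s_{i,v_ℚ} ≤ σ_{i+1,v_ℚ}` at the labels
`i+1 ≤ j₀`, with `PN(i ↦ [i+1 > j₀]·((i+1)² − 1)) · deĝ̲(P_q) ≤ PN(i ↦ [i+1 ≤ j₀]·Σᶠ_v s_{i,v})`, give the typed Statement. This is the inequality a C1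
candidate's k2 sketch reduces to at genuine data: LEFT side = a number of the datum (`l⋆`, `j₀`, `deĝ̲(P_q) = (1/2l)·deĝ̲(𝔮)`), RIGHT side = the
below-cut surplus NUMBERS it brings. [cite: DupuyHilado2025, §3.3, Thm 3.10.1] [claim: Mochizuki2012, status: disputed] -/
theorem statement_settingPrVolSharp_of_surplusBelow_ge_explicitFloorMass (s : Fin (thetaIndex X).lstar → (thetaIndex X).VQ → ℝ)
    (hsfin : ∀ i : Fin (thetaIndex X).lstar, (Function.support (s i)).Finite)
    (hs : ∀ (i : Fin (thetaIndex X).lstar) (vQ : (thetaIndex X).VQ), (i : ℕ) + 1 ≤ j₀ →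
      s i vQ ≤ ((situationPrVol X hlog M archPk archSub Ψ act Mmod region).D n).logvol _ vQ
            ((settingPrVolSharp X hlog M archPk archSub Ψ act Mmod region n lat sig split qData tq t htq0 htq1).thetaHull
              (Setting.labelSucc i) vQ) -
          (settingPrVolSharp X hlog M archPk archSub Ψ act Mmod region n lat sig split qData tq t htq0 htq1).qLocal
            (Setting.labelSucc i) vQ)
    (hbudget : processionNormalized (fun i : Fin (thetaIndex X).lstar =>
          if (i : ℕ) + 1 ≤ j₀ then (0 : ℝ) else ((((i : ℕ) + 1 : ℕ) : ℝ) ^ 2 - 1)) * FinDivisor.ndeg F X.qPilot ≤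
      processionNormalized (fun i : Fin (thetaIndex X).lstar => if (i : ℕ) + 1 ≤ j₀ then ∑ᶠ vQ : (thetaIndex X).VQ, s i vQ else 0)) :
    (settingPrVolSharp X hlog M archPk archSub Ψ act Mmod region n lat sig split qData tq t htq0 htq1).Statement := by
  have hfin := thetaFinite X hlog M archPk archSub Ψ act Mmod region n lat sig split qData t tq ht0 ht htq0 htq1
  refine (ObstructionSS28Window.statement_iff_avg_cellSlack
    (LatticeSituation.ofShells (logShellsDH X logv) M archPk archSub (summandPiecesPr X hlog).Adm (summandPiecesPr X hlog).logvol Ψ act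
      Mmod region (fun _ _ => (summandPiecesPr X hlog).Adm) (fun _ _ => (summandPiecesPr X hlog).logvol) (fun k _ => Ψ k)
      (fun k _ => Mmod k) (fun _ _ _ _ _ => ∅) (fun _ _ _ _ => ∅) (fun _ _ _ => 0))
    (settingPrVolSharp X hlog M archPk archSub Ψ act Mmod region n lat sig split qData tq t htq0 htq1) hfin).mpr ?_
  show 0 ≤ processionNormalized (fun i : Fin (thetaIndex X).lstar => ∑ᶠ vQ : (thetaIndex X).VQ,
        (((situationPrVol X hlog M archPk archSub Ψ act Mmod region).D n).logvol _ vQ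
            ((settingPrVolSharp X hlog M archPk archSub Ψ act Mmod region n lat sig split qData tq t htq0 htq1).thetaHull
              (Setting.labelSucc i) vQ) -
          (settingPrVolSharp X hlog M archPk archSub Ψ act Mmod region n lat sig split qData tq t htq0 htq1).qLocal
            (Setting.labelSucc i) vQ))
  -- the floor mass as a number
  rw [← floorMassAbove_settingPrVolSharp_eq X hlog M archPk archSub Ψ act Mmod region n lat sig split qData t tq htq0 htq1 htq j₀] at hbudget
  -- the label-wise lower ledger: `s`-sum below the cut, minus the floor sum above it
  have hg : processionNormalized (fun i : Fin (thetaIndex X).lstar => if (i : ℕ) + 1 ≤ j₀ then ∑ᶠ vQ : (thetaIndex X).VQ, s i vQ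
      else -∑ᶠ vQ : (thetaIndex X).VQ, ((((i : ℕ) + 1 : ℕ) : ℝ) ^ 2 - 1) *
        (-(settingPrVolSharp X hlog M archPk archSub Ψ act Mmod region n lat sig split qData tq t htq0 htq1).qLocal
          (Setting.labelSucc i) vQ)) ≤
      processionNormalized (fun i : Fin (thetaIndex X).lstar => ∑ᶠ vQ : (thetaIndex X).VQ,
        (((situationPrVol X hlog M archPk archSub Ψ act Mmod region).D n).logvol _ vQ
            ((settingPrVolSharp X hlog M archPk archSub Ψ act Mmod region n lat sig split qData tq t htq0 htq1).thetaHull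
              (Setting.labelSucc i) vQ) -
          (settingPrVolSharp X hlog M archPk archSub Ψ act Mmod region n lat sig split qData tq t htq0 htq1).qLocal
            (Setting.labelSucc i) vQ)) := by
    refine processionNormalized_mono fun i => ?_
    split_ifs with hi
    · exact finsum_le_finsum' (hsfin i)
        (ObstructionSS28Window.cellSlack_support_finite
          (LatticeSituation.ofShells (logShellsDH X logv) M archPk archSub (summandPiecesPr X hlog).Adm (summandPiecesPr X hlog).logvol Ψ act
            Mmod region (fun _ _ => (summandPiecesPr X hlog).Adm) (fun _ _ => (summandPiecesPr X hlog).logvol) (fun k _ => Ψ k)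
            (fun k _ => Mmod k) (fun _ _ _ _ _ => ∅) (fun _ _ _ _ => ∅) (fun _ _ _ => 0))
          (settingPrVolSharp X hlog M archPk archSub Ψ act Mmod region n lat sig split qData tq t htq0 htq1) hfin i)
        fun vQ => hs i vQ hi
    · exact finsum_cellSlack_ge_neg_finsum_floor_settingPrVolSharp X hlog M archPk archSub Ψ act Mmod region n lat sig split qData t tq
        ht0 ht htq0 htq1 htq i
  -- `PN g = PN(below s) − PN(above floor)`
  have hsplit : processionNormalized (fun i : Fin (thetaIndex X).lstar => if (i : ℕ) + 1 ≤ j₀ then ∑ᶠ vQ : (thetaIndex X).VQ, s i vQ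
      else -∑ᶠ vQ : (thetaIndex X).VQ, ((((i : ℕ) + 1 : ℕ) : ℝ) ^ 2 - 1) *
        (-(settingPrVolSharp X hlog M archPk archSub Ψ act Mmod region n lat sig split qData tq t htq0 htq1).qLocal
          (Setting.labelSucc i) vQ)) =
      processionNormalized (fun i : Fin (thetaIndex X).lstar => if (i : ℕ) + 1 ≤ j₀ then ∑ᶠ vQ : (thetaIndex X).VQ, s i vQ else 0) -
        processionNormalized (fun i : Fin (thetaIndex X).lstar => if (i : ℕ) + 1 ≤ j₀ then 0 else
          ∑ᶠ vQ : (thetaIndex X).VQ, ((((i : ℕ) + 1 : ℕ) : ℝ) ^ 2 - 1) *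
            (-(settingPrVolSharp X hlog M archPk archSub Ψ act Mmod region n lat sig split qData tq t htq0 htq1).qLocal
              (Setting.labelSucc i) vQ)) := by
    unfold processionNormalized
    rw [← sub_div, ← Finset.sum_sub_distrib]
    congr 1
    refine Finset.sum_congr rfl fun i _ => ?_
    by_cases hi : (i : ℕ) + 1 ≤ j₀
    · simp only [if_pos hi, sub_zero]
    · simp only [if_neg hi, zero_sub]
  rw [hsplit] at hg
  linarith

include ht0 ht htq in
/-- **The same door with licence cells as the only below-cut input (`s = 0`) opens only for cuts at or above `l⋆`** — the precise sense in which
«I06⋆ / licence at `j ≤ j₀`» ALONE does not reach the typed Corollary at genuine data (for `j₀ < l⋆` its hypothesis is refuted by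
`not_explicitFloorMass_le_zero_of_lt`), recorded as an implication for the k2 sheets. [claim: Mochizuki2012, status: disputed] -/
theorem statement_settingPrVolSharp_of_licenceBelow_of_explicitFloorMass_nonpos
    (hbelow : ∀ (i : Fin (thetaIndex X).lstar) (vQ : (thetaIndex X).VQ), (i : ℕ) + 1 ≤ j₀ →
      (settingPrVolSharp X hlog M archPk archSub Ψ act Mmod region n lat sig split qData tq t htq0 htq1).qRegion (Setting.labelSucc i) vQ ⊆
        (settingPrVolSharp X hlog M archPk archSub Ψ act Mmod region n lat sig split qData tq t htq0 htq1).thetaHull (Setting.labelSucc i) vQ)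
    (hbudget : processionNormalized (fun i : Fin (thetaIndex X).lstar =>
          if (i : ℕ) + 1 ≤ j₀ then (0 : ℝ) else ((((i : ℕ) + 1 : ℕ) : ℝ) ^ 2 - 1)) * FinDivisor.ndeg F X.qPilot ≤ 0) :
    Thm311ToCor312.Licence (settingPrVolSharp X hlog M archPk archSub Ψ act Mmod region n lat sig split qData tq t htq0 htq1) ∧
      (settingPrVolSharp X hlog M archPk archSub Ψ act Mmod region n lat sig split qData tq t htq0 htq1).Statement := by
  have h0 : processionNormalized (fun i : Fin (thetaIndex X).lstar => if (i : ℕ) + 1 ≤ j₀ then 0 else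
        ∑ᶠ vQ : (thetaIndex X).VQ, ((((i : ℕ) + 1 : ℕ) : ℝ) ^ 2 - 1) *
          (-(settingPrVolSharp X hlog M archPk archSub Ψ act Mmod region n lat sig split qData tq t htq0 htq1).qLocal
            (Setting.labelSucc i) vQ)) ≤ 0 := by
    rw [floorMassAbove_settingPrVolSharp_eq X hlog M archPk archSub Ψ act Mmod region n lat sig split qData t tq htq0 htq1 htq j₀]
    exact hbudget
  have htop := lstar_le_of_explicitFloorMass_nonpos X hlog M archPk archSub Ψ act Mmod region n lat sig split qData t tq htq0 htq1 htq j₀ h0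
  exact licence_settingPrVolSharp_of_licenceBelow_of_lstar_le X hlog M archPk archSub Ψ act Mmod region n lat sig split qData t tq ht0 ht
    htq0 htq1 (fun _ => j₀) (fun _ => htop) (fun i vQ hi => hbelow i vQ hi)

end ConstantCut

end Summit.ABC.IUTFork.Repair.RHLabelCutGenuine

end
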